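import Literature.Analysis.Complex.SmoothHypersurfaceDivision
import HarnessLib

/-!
# Hadamard's lemma for holomorphic functions on product domains

R. C. Gunning, H. Rossi, *Analytic Functions of Several Complex Variables* (1965), Ch. I §A
(Taylor expansion; "`f(z) - f(a) = Σ (zᵢ - aᵢ) gᵢ(z)`") / E. M. Chirka, *Complex Analytic Sets*
(1989), A1.1: on a product domain `P = {z | ℓᵢ(z - a) ∈ Dᵢ for all i}` (coordinates `ℓᵢ` dual to
a finite basis `eᵢ`, planar opens `Dᵢ ∋ 0`; e.g. a polydisc, or a finite intersection of polydiscs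
in the same coordinates all containing `a`), every holomorphic `f` (values in a complete space)
writes

  `f z = f a + Σᵢ ℓᵢ(z - a) • gᵢ z`  with `gᵢ` holomorphic on `P`  (`exists_eq_add_sum_smul`),

so that `𝒪(P)/(ℓ₁(· - a), …, ℓₙ(· - a)) 𝒪(P) ≅ ℂ` by evaluation at `a` — the computation of the
bottom (skyscraper) level of the iterated hyperplane-section cokernels in Serre's dimension count.
Proof WITHOUT parametric integrals: kill one coordinate at a time with the projection
`z ↦ z - ℓⱼ(z - a) eⱼ` (which preserves `P` because `0 ∈ Dⱼ`) and divide the difference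
`f(π z) - f(π (πⱼ z))`, which vanishes on `{ℓⱼ(z - a) = 0}`, by the reduced linear equation
`ℓⱼ(· - a)` using `exists_eq_smul_of_eqOn_zero` (`SmoothHypersurfaceDivision`).

Theorems only.

## References

* R. C. Gunning, H. Rossi, *Analytic Functions of Several Complex Variables* (1965), Ch. I §A.
  [folklore]
* E. M. Chirka, *Complex Analytic Sets* (1989), A1.1. [Chirka1989]
-/

noncomputable section

open Metric Set Filter
open scoped Topology

namespace Literature.Analysis.Complex
namespace SCV

variable {E : Type*} [NormedAddCommGroup E] [NormedSpace ℂ E]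
  {F : Type*} [NormedAddCommGroup F] [NormedSpace ℂ F] [CompleteSpace F]
  {ι : Type*} [Fintype ι] [DecidableEq ι]

omit [Fintype ι] in
/-- The coordinates of a coordinate projection: killing the coordinates in `s` (setting them to
those of `a`) leaves the other coordinates unchanged. [folklore] -/
theorem apply_sub_sum_smul_sub (e : ι → E) (ℓ : ι → E →L[ℂ] ℂ)
    (hdual : ∀ i j, ℓ i (e j) = if i = j then 1 else 0) (a : E) (s : Finset ι) (z : E) (j : ι) :
    ℓ j (z - ∑ i ∈ s, ℓ i (z - a) • e i - a) = if j ∈ s then 0 else ℓ j (z - a) := by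
  have h1 : ℓ j (∑ i ∈ s, ℓ i (z - a) • e i) = ∑ i ∈ s, ℓ i (z - a) * ℓ j (e i) := by
    rw [map_sum]
    refine Finset.sum_congr rfl fun i _ ↦ ?_
    rw [map_smul, smul_eq_mul]
  have h2 : ∑ i ∈ s, ℓ i (z - a) * ℓ j (e i) = if j ∈ s then ℓ j (z - a) else 0 := by
    simp_rw [hdual, mul_ite, mul_one, mul_zero]
    rw [Finset.sum_ite_eq s j]
  rw [show z - ∑ i ∈ s, ℓ i (z - a) • e i - a = (z - a) - ∑ i ∈ s, ℓ i (z - a) • e i by abel,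
    map_sub, h1, h2]
  split_ifs <;> simp

/-- **Hadamard's lemma for holomorphic functions on a product domain.** Let `eᵢ`, `ℓᵢ` (`i` in a
finite type) be a biorthogonal system spanning `E` (`ℓᵢ(eⱼ) = δᵢⱼ`, `Σ ℓᵢ(z) eᵢ = z`), `a ∈ E`,
`Dᵢ ⊆ ℂ` open with `0 ∈ Dᵢ`, and `P = {z | ∀ i, ℓᵢ(z - a) ∈ Dᵢ}`. Every `f` holomorphic on `P`
with values in a complete space satisfies `f z = f a + Σᵢ ℓᵢ(z - a) • gᵢ z` on `P` for some `gᵢ`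
holomorphic on `P`. [cite: Chirka1989, A1.1] -/
theorem exists_eq_add_sum_smul (e : ι → E) (ℓ : ι → E →L[ℂ] ℂ)
    (hdual : ∀ i j, ℓ i (e j) = if i = j then 1 else 0) (hspan : ∀ z : E, ∑ i, ℓ i z • e i = z)
    (a : E) (D : ι → Set ℂ) (hD : ∀ i, IsOpen (D i)) (hD0 : ∀ i, (0 : ℂ) ∈ D i) {f : E → F}
    (hf : DifferentiableOn ℂ f {z | ∀ i, ℓ i (z - a) ∈ D i}) :
    ∃ g : ι → E → F, (∀ i, DifferentiableOn ℂ (g i) {z | ∀ i, ℓ i (z - a) ∈ D i}) ∧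
      ∀ z ∈ {z | ∀ i, ℓ i (z - a) ∈ D i}, f z = f a + ∑ i, ℓ i (z - a) • g i z := by
  set P : Set E := {z | ∀ i, ℓ i (z - a) ∈ D i} with hP
  -- `P` is open and contains `a`
  have hPo : IsOpen P := by
    have : P = ⋂ i, (fun z ↦ ℓ i (z - a)) ⁻¹' D i := by ext z; simp [hP]
    rw [this]
    exact isOpen_iInter_of_finite fun i ↦ (hD i).preimage (by fun_prop)
  have haP : a ∈ P := fun i ↦ by simpa using hD0 i
  -- the coordinate projections `π s`
  set π : Finset ι → E → E := fun s z ↦ z - ∑ i ∈ s, ℓ i (z - a) • e i with hπ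
  have hπℓ : ∀ (s : Finset ι) (z : E) (j : ι),
      ℓ j (π s z - a) = if j ∈ s then 0 else ℓ j (z - a) := fun s z j ↦
    apply_sub_sum_smul_sub e ℓ hdual a s z j
  have hπP : ∀ (s : Finset ι), ∀ z ∈ P, π s z ∈ P := fun s z hz j ↦ by
    rw [hπℓ]
    split_ifs
    · exact hD0 j
    · exact hz j
  have hπd : ∀ s : Finset ι, Differentiable ℂ (π s) := fun s ↦ by
    simp only [hπ]
    fun_prop
  have hπa : ∀ s : Finset ι, π s a = a := fun s ↦ by simp [hπ]
  -- composition of projections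
  have hππ : ∀ (s : Finset ι) (j : ι), j ∉ s → ∀ z,
      π s (z - ℓ j (z - a) • e j) = π (insert j s) z := fun s j hj z ↦ by
    simp only [hπ]
    rw [Finset.sum_insert hj]
    have h1 : ∀ i ∈ s, ℓ i (z - ℓ j (z - a) • e j - a) • e i = ℓ i (z - a) • e i := fun i hi ↦ by
      have hij : i ≠ j := ne_of_mem_of_not_mem hi hj
      rw [show z - ℓ j (z - a) • e j - a = (z - a) - ℓ j (z - a) • e j by abel, map_sub, map_smul,
        hdual, if_neg hij, smul_zero, sub_zero]
    rw [Finset.sum_congr rfl h1]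
    abel
  -- induction on the set of killed coordinates
  have claim : ∀ s : Finset ι, ∃ g : ι → E → F, (∀ i, DifferentiableOn ℂ (g i) P) ∧
      ∀ z ∈ P, f z = f (π s z) + ∑ i ∈ s, ℓ i (z - a) • g i z := by
    intro s
    induction s using Finset.induction_on with
    | empty => exact ⟨fun _ _ ↦ 0, fun _ ↦ differentiableOn_const 0, fun z _ ↦ by simp [hπ]⟩
    | insert j s hj ih =>
      obtain ⟨g, hg, hfg⟩ := ih
      -- the difference `k z = f (π s z) - f (π (insert j s) z)` vanishes on `{ℓ j (z - a) = 0}`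
      set t : E → ℂ := fun z ↦ ℓ j (z - a) with ht
      set k : E → F := fun z ↦ f (π s z) - f (π (insert j s) z) with hk
      have htd : DifferentiableOn ℂ t P := by simp only [ht]; fun_prop
      have hfπ : ∀ s' : Finset ι, DifferentiableOn ℂ (fun z ↦ f (π s' z)) P := fun s' ↦
        hf.comp (hπd s').differentiableOn (hπP s')
      have hkd : DifferentiableOn ℂ k P := (hfπ s).sub (hfπ (insert j s))
      have hdt : ∀ x ∈ P, t x = 0 → fderiv ℂ t x ≠ 0 := fun x _ _ ↦ by
        have h1 : HasFDerivAt t (ℓ j) x := by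
          have := (ℓ j).hasFDerivAt.sub_const (ℓ j a) (x := x)
          simp only [ht]
          refine this.congr_of_eventuallyEq (Eventually.of_forall fun y ↦ ?_)
          simp [map_sub]
        rw [h1.fderiv]
        intro h0
        have := congrArg (fun L : E →L[ℂ] ℂ ↦ L (e j)) h0
        simp [hdual] at this
      have hkt : ∀ x ∈ P, t x = 0 → k x = 0 := fun x _ hx0 ↦ by
        simp only [hk, ← hππ s j hj x]
        rw [show ℓ j (x - a) = 0 from hx0, zero_smul, sub_zero, sub_self]
      obtain ⟨gj, hgj, hkgj⟩ := exists_eq_smul_of_eqOn_zero hPo htd hkd hdt hkt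
      refine ⟨Function.update g j gj, fun i ↦ ?_, fun z hz ↦ ?_⟩
      · rcases eq_or_ne i j with rfl | hij
        · rwa [Function.update_self]
        · rw [Function.update_of_ne hij]; exact hg i
      · rw [Finset.sum_insert hj, Function.update_self]
        have h2 : ∑ i ∈ s, ℓ i (z - a) • Function.update g j gj i z = ∑ i ∈ s, ℓ i (z - a) • g i z :=
          Finset.sum_congr rfl fun i hi ↦ by
            rw [Function.update_of_ne (ne_of_mem_of_not_mem hi hj)]
        rw [h2, hfg z hz]
        have h3 := hkgj z hz
        simp only [hk, ht] at h3
        rw [sub_eq_iff_eq_add] at h3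
        rw [h3]
        abel
  obtain ⟨g, hg, hfg⟩ := claim Finset.univ
  refine ⟨g, hg, fun z hz ↦ ?_⟩
  have hπu : π Finset.univ z = a := by
    simp only [hπ]
    have := hspan (z - a)
    rw [this]
    abel
  rw [hfg z hz, hπu]

/-- **`𝒪(P)/(ℓ₁, …, ℓₙ) = ℂ` on a product domain**: a holomorphic `f` vanishing at the centre `a`
lies in the ideal generated by the coordinates `ℓᵢ(· - a)` with holomorphic coefficients.
[cite: Chirka1989, A1.1] -/
theorem exists_eq_sum_smul_of_apply_eq_zero (e : ι → E) (ℓ : ι → E →L[ℂ] ℂ)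
    (hdual : ∀ i j, ℓ i (e j) = if i = j then 1 else 0) (hspan : ∀ z : E, ∑ i, ℓ i z • e i = z)
    (a : E) (D : ι → Set ℂ) (hD : ∀ i, IsOpen (D i)) (hD0 : ∀ i, (0 : ℂ) ∈ D i) {f : E → F}
    (hf : DifferentiableOn ℂ f {z | ∀ i, ℓ i (z - a) ∈ D i}) (hfa : f a = 0) :
    ∃ g : ι → E → F, (∀ i, DifferentiableOn ℂ (g i) {z | ∀ i, ℓ i (z - a) ∈ D i}) ∧
      ∀ z ∈ {z | ∀ i, ℓ i (z - a) ∈ D i}, f z = ∑ i, ℓ i (z - a) • g i z := by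
  obtain ⟨g, hg, hfg⟩ := exists_eq_add_sum_smul e ℓ hdual hspan a D hD hD0 hf
  exact ⟨g, hg, fun z hz ↦ by rw [hfg z hz, hfa, zero_add]⟩

end SCV
end Literature.Analysis.Complex
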